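import Literature.NumberTheory.Sieve.ThetaFixedLattice
import Literature.Analysis.FunctionSpaces.TorusPlateauCutoff
import HarnessLib

/-!
# Uniform derivative bounds for the twisted log-weight `Φ_t · e(κ_χ ·)`

Topic `Literature/NumberTheory/Sieve`, sub-namespace `ThetaUnits` (continued). The decay of the
Fourier coefficients `ĉ(k, t)` of `ThetaFixedLattice` is controlled (`norm_coeff_periodizeC_le`,
`norm_iteratedFDeriv_periodizeC_le`) by sup norms of the iterated derivatives of the twisted bump
`gTw χ kf M t = Φ_t · e(κ_χ ·)` on `logSpace K`. Here `Φ_t(h) = ∏_w k_w((ofTH(t,h))_w − log M)` is a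
product over the `d` real places of one-variable profiles composed with affine maps whose linear
parts `lamW w` have norm `≤ rk + 1`, and `e(κ_χ h) = cos(2πκ_χ h) + i sin(2πκ_χ h)`. The all-orders
Leibniz bound for many factors of the tree (`norm_iteratedFDeriv_finset_prod_le_pow`,
TorusPlateauCutoff) gives, for profiles with `|k_w| ≤ 1` and `|k_w^{(a)}| ≤ L₀ᵃ` (`1 ≤ a ≤ n`):

* `lamW`, `norm_lamW_le` (`≤ rk + 1`); `norm_iteratedFDeriv_factor_le` (`≤ (L₀ (rk+1))ᵃ`);
* `norm_iteratedFDeriv_PhiT_le` — `‖Dᵃ Φ_t‖ ≤ (d L₀ (rk+1))ᵃ`, `|Φ_t| ≤ 1`;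
* `norm_iteratedFDeriv_eC_kappa_le` — `‖Dᵃ e(κ_χ ·)‖ ≤ (4π‖κ_χ‖)ᵃ` (`a ≥ 1`);
* **`norm_iteratedFDeriv_gTw_le`** — `‖Dᵃ gTw‖ ≤ (d L₀ (rk+1) + 4π‖κ_χ‖)ᵃ` for `a ≤ n`, uniformly in
  `t`, `M`, `h` (and in `χ`, `𝔣` through `abs_kappa_le`).

## References

* T. Mitsui, Jap. J. Math. 26 (1956), §3. [cite: Mitsui1956, §3]
* J. Hinz, Acta Arith. 51 (1988), §2. [cite: Hinz1988, §2]
-/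

noncomputable section

open NumberField NumberField.InfinitePlace NumberField.Units NumberField.Units.dirichletUnitTheorem
  Literature.NumberTheory.LFunctions Literature.NumberTheory.LFunctions.HeckeCone
  Literature.NumberTheory.Sieve.UnitKernel Literature.NumberTheory.Sieve.UnitPeriodic
  Literature.Algebra.EuclideanLattices.LatticePeriodic Module
  Literature.Analysis.FunctionSpaces
open scoped Classical

namespace Literature.NumberTheory.Sieve.ThetaUnits

variable {K : Type*} [Field K] [NumberField K] [IsTotallyReal K]

local notation "RP" => {w : InfinitePlace K // IsReal w}
local notation "rkE" => finrank ℝ (logSpace K)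

/-! ## The linear parts of the affine maps `h ↦ (ofTH (t, h))_w` -/

variable (K) in
/-- `lamW w : h ↦ (ofTH (0, h))_w`, the linear part of `h ↦ (ofTH (t, h))_w`. [folklore] -/
def lamW (w : InfinitePlace K) : logSpace K →L[ℝ] ℝ := (ContinuousLinearMap.proj w).comp (ofTHLin (K := K))

omit [IsTotallyReal K] in
/-- Unfolding `lamW`. [folklore] -/
theorem lamW_apply (w : InfinitePlace K) (h : logSpace K) : lamW K w h = ofTH K (0, h) w := rfl

omit [IsTotallyReal K] in
/-- `(ofTH (t, h))_w = (ofTH (t, 0))_w + lamW w h`. [folklore] -/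
theorem ofTH_apply_eq (t : ℝ) (h : logSpace K) (w : InfinitePlace K) : ofTH K (t, h) w = ofTH K (t, 0) w + lamW K w h := by
  rw [ofTH_eq_add, Pi.add_apply, lamW_apply]

omit [IsTotallyReal K] in
/-- **`‖lamW w‖ ≤ rk + 1`** (`rk = #{w ≠ w₀}`, sup norm on `logSpace K`). [folklore] -/
theorem norm_lamW_le (w : InfinitePlace K) :
    ‖lamW K w‖ ≤ (Fintype.card {w : InfinitePlace K // w ≠ w₀} : ℝ) + 1 := by
  refine ContinuousLinearMap.opNorm_le_bound _ (by positivity) fun h => ?_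
  have hmult : ∀ w : InfinitePlace K, (1 : ℝ) ≤ (mult w : ℝ) := fun w => by
    rw [mult]; split_ifs <;> norm_num
  have hcoord : ∀ w' : {w : InfinitePlace K // w ≠ w₀}, |h w'| ≤ ‖h‖ := fun w' => by
    rw [← Real.norm_eq_abs]; exact norm_le_pi_norm h w'
  rw [lamW_apply, Real.norm_eq_abs]
  simp only [ofTH]
  split_ifs with hw
  · rw [zero_sub, abs_neg, abs_div, abs_of_pos (lt_of_lt_of_le one_pos (hmult w))]
    calc |∑ w', h w'| / (mult w : ℝ) ≤ |∑ w', h w'| / 1 :=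
          div_le_div_of_nonneg_left (abs_nonneg _) one_pos (hmult w)
      _ ≤ ∑ w' : {w : InfinitePlace K // w ≠ w₀}, ‖h‖ := by
          rw [div_one]; exact (Finset.abs_sum_le_sum_abs _ _).trans (Finset.sum_le_sum fun w' _ => hcoord w')
      _ = (Fintype.card {w : InfinitePlace K // w ≠ w₀} : ℝ) * ‖h‖ := by
          rw [Finset.sum_const, Finset.card_univ, nsmul_eq_mul]
      _ ≤ ((Fintype.card {w : InfinitePlace K // w ≠ w₀} : ℝ) + 1) * ‖h‖ := by
          nlinarith [norm_nonneg h]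
  · rw [zero_add, abs_div, abs_of_pos (lt_of_lt_of_le one_pos (hmult w))]
    calc |h ⟨w, hw⟩| / (mult w : ℝ) ≤ |h ⟨w, hw⟩| / 1 := div_le_div_of_nonneg_left (abs_nonneg _) one_pos (hmult w)
      _ ≤ ‖h‖ := by rw [div_one]; exact hcoord ⟨w, hw⟩
      _ ≤ ((Fintype.card {w : InfinitePlace K // w ≠ w₀} : ℝ) + 1) * ‖h‖ := by
          nlinarith [norm_nonneg h]

/-! ## One factor -/

omit [IsTotallyReal K] in
/-- **One factor**: for a smooth profile `k` with `|k^{(a)}| ≤ L₀ᵃ` (`1 ≤ a ≤ n`),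
`‖Dᵃ (h ↦ k((ofTH(t,h))_w − log M))‖ ≤ (L₀ (rk+1))ᵃ` for `1 ≤ a ≤ n`. [folklore] -/
theorem norm_iteratedFDeriv_factor_le {k : ℝ → ℝ} (hk : ContDiff ℝ (⊤ : ℕ∞) k) {L₀ : ℝ} (hL₀ : 0 ≤ L₀) {n : ℕ}
    (hD : ∀ a, 1 ≤ a → a ≤ n → ∀ s, ‖iteratedDeriv a k s‖ ≤ L₀ ^ a) (M t : ℝ) (w : InfinitePlace K)
    {a : ℕ} (ha1 : 1 ≤ a) (ha : a ≤ n) (h : logSpace K) :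
    ‖iteratedFDeriv ℝ a (fun h : logSpace K => k (ofTH K (t, h) w - Real.log M)) h‖ ≤
      (L₀ * ((Fintype.card {w : InfinitePlace K // w ≠ w₀} : ℝ) + 1)) ^ a := by
  set c : ℝ := ofTH K (t, 0) w - Real.log M with hc
  set g : ℝ → ℝ := fun s => k (s + c) with hg
  have hfun : (fun h : logSpace K => k (ofTH K (t, h) w - Real.log M)) = g ∘ (lamW K w) := by
    funext h'
    simp only [Function.comp_apply, hg, hc]
    rw [ofTH_apply_eq]; ring_nf
  have hgs : ContDiff ℝ (⊤ : ℕ∞) g := hk.comp (contDiff_id.add contDiff_const)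
  rw [hfun, (lamW K w).iteratedFDeriv_comp_right hgs h (by exact_mod_cast le_top)]
  refine (ContinuousMultilinearMap.norm_compContinuousLinearMap_le _ _).trans ?_
  rw [Finset.prod_const, Finset.card_univ, Fintype.card_fin, mul_pow]
  refine mul_le_mul ?_ (pow_le_pow_left₀ (norm_nonneg _) (norm_lamW_le w) a) (by positivity) (by positivity)
  rw [norm_iteratedFDeriv_eq_norm_iteratedDeriv, hg, iteratedDeriv_comp_add_const]
  exact hD a ha1 ha _

/-! ## The product `Φ_t` -/

omit [IsTotallyReal K] in
/-- `h ↦ ofTH (t, h)` is smooth (affine). [folklore] -/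
theorem contDiff_ofTH (t : ℝ) : ContDiff ℝ (⊤ : ℕ∞) fun h : logSpace K => ofTH K (t, h) := by
  have : (fun h : logSpace K => ofTH K (t, h)) = fun h => ofTH K (t, 0) + ofTHLin (K := K) h := by
    funext h; rw [ofTH_eq_add, ofTHLin_apply]
  rw [this]
  exact contDiff_const.add (ofTHLin (K := K)).contDiff

omit [IsTotallyReal K] in
/-- Each factor of `Φ_t` is smooth. [folklore] -/
theorem contDiff_factor {k : ℝ → ℝ} (hk : ContDiff ℝ (⊤ : ℕ∞) k) (M t : ℝ) (w : InfinitePlace K) :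
    ContDiff ℝ (⊤ : ℕ∞) fun h : logSpace K => k (ofTH K (t, h) w - Real.log M) :=
  hk.comp (((contDiff_apply ℝ ℝ w).comp (contDiff_ofTH t)).sub contDiff_const)

omit [IsTotallyReal K] in
/-- **`‖Dᵃ Φ_t‖ ≤ (d L₀ (rk+1))ᵃ`** for `a ≤ n` (profiles bounded by `1` with `|k_w^{(a)}| ≤ L₀ᵃ`),
uniformly in `t`, `M`, `h`. [cite: Hinz1988, §2] -/
theorem norm_iteratedFDeriv_PhiT_le {kf : RP → ℝ → ℝ} (hk : ∀ w, ContDiff ℝ (⊤ : ℕ∞) (kf w))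
    (h1 : ∀ w v, ‖kf w v‖ ≤ 1) {L₀ : ℝ} (hL₀ : 0 ≤ L₀) {n : ℕ}
    (hD : ∀ w a, 1 ≤ a → a ≤ n → ∀ s, ‖iteratedDeriv a (kf w) s‖ ≤ L₀ ^ a) (M t : ℝ) {a : ℕ} (ha : a ≤ n) (h : logSpace K) :
    ‖iteratedFDeriv ℝ a (PhiT K kf M t) h‖ ≤
      ((Fintype.card RP : ℝ) * (L₀ * ((Fintype.card {w : InfinitePlace K // w ≠ w₀} : ℝ) + 1))) ^ a := by
  have hfun : PhiT K kf M t = fun h : logSpace K => ∏ w : RP, kf w (ofTH K (t, h) w.1 - Real.log M) := rfl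
  rw [hfun]
  have h := norm_iteratedFDeriv_finset_prod_le_pow (E := logSpace K) (Finset.univ : Finset RP)
    (f := fun (w : RP) (h : logSpace K) => kf w (ofTH K (t, h) w.1 - Real.log M))
    (L := fun _ => L₀ * ((Fintype.card {w : InfinitePlace K // w ≠ w₀} : ℝ) + 1)) (n := n)
    (fun w _ => (contDiff_factor (hk w) M t w.1).of_le (by exact_mod_cast le_top))
    (fun w _ _ => h1 w _) (fun w _ => by positivity)
    (fun w _ b hb1 hb x => norm_iteratedFDeriv_factor_le (hk w) hL₀ (hD w) M t w.1 hb1 hb x) a ha h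
  rw [Finset.sum_const, Finset.card_univ, nsmul_eq_mul] at h
  exact h

omit [IsTotallyReal K] in
/-- `|Φ_t| ≤ 1` for profiles bounded by `1`. [folklore] -/
theorem norm_PhiT_le_one {kf : RP → ℝ → ℝ} (h1 : ∀ w v, ‖kf w v‖ ≤ 1) (M t : ℝ) (h : logSpace K) :
    ‖PhiT K kf M t h‖ ≤ 1 :=
  norm_finset_prod_le_one (Finset.univ : Finset RP) (f := fun (w : RP) (h : logSpace K) => kf w (ofTH K (t, h) w.1 - Real.log M))
    (fun w _ _ => h1 w _) h

/-! ## The character factor `e(κ_χ h)` -/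

variable {𝔣 : Ideal (𝓞 K)} (χ : AddChar (Additive ((𝓞 K ⧸ 𝔣)ˣ)) ℂ)

/-- `e(κ h) = cos(ℓ h) + sin(ℓ h) i` with `ℓ = 2π κ_χ`. [folklore] -/
theorem eC_kappa_eq (h : logSpace K) :
    eC (kappa χ h) = (Real.cos (((2 * Real.pi) • kappa χ) h) : ℂ) + (Real.sin (((2 * Real.pi) • kappa χ) h) : ℂ) * Complex.I := by
  rw [eC, _root_.smul_apply, smul_eq_mul, Complex.ofReal_cos, Complex.ofReal_sin, ← Complex.exp_mul_I]
  congr 1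
  push_cast
  ring

omit [IsTotallyReal K] in
/-- A one-variable smooth function with all derivatives bounded by `1`, composed with a linear
form `ℓ` and embedded in `ℂ`: `‖Dᵃ‖ ≤ ‖ℓ‖ᵃ`. [folklore] -/
theorem norm_iteratedFDeriv_ofReal_comp_le {f : ℝ → ℝ} (hf : ContDiff ℝ (⊤ : ℕ∞) f)
    (hb : ∀ a s, ‖iteratedDeriv a f s‖ ≤ 1) (ℓ : logSpace K →L[ℝ] ℝ) (a : ℕ) (h : logSpace K) :
    ‖iteratedFDeriv ℝ a (fun h : logSpace K => (f (ℓ h) : ℂ)) h‖ ≤ ‖ℓ‖ ^ a := by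
  have hcomp : (fun h : logSpace K => (f (ℓ h) : ℂ)) = Complex.ofRealLI ∘ (f ∘ ℓ) := rfl
  rw [hcomp, LinearIsometry.norm_iteratedFDeriv_comp_left _ ((hf.comp ℓ.contDiff).contDiffAt) (by exact_mod_cast le_top),
    ℓ.iteratedFDeriv_comp_right hf h (by exact_mod_cast le_top)]
  refine (ContinuousMultilinearMap.norm_compContinuousLinearMap_le _ _).trans ?_
  rw [Finset.prod_const, Finset.card_univ, Fintype.card_fin, norm_iteratedFDeriv_eq_norm_iteratedDeriv]
  exact mul_le_of_le_one_left (by positivity) (hb a _)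

/-- **`‖Dᵃ e(κ_χ ·)‖ ≤ 2 ‖2π κ_χ‖ᵃ`.** [folklore] -/
theorem norm_iteratedFDeriv_eC_kappa_le (a : ℕ) (h : logSpace K) :
    ‖iteratedFDeriv ℝ a (fun h : logSpace K => eC (kappa χ h)) h‖ ≤ 2 * ‖(2 * Real.pi) • kappa χ‖ ^ a := by
  set ℓ : logSpace K →L[ℝ] ℝ := (2 * Real.pi) • kappa χ with hℓ
  have hfun : (fun h : logSpace K => eC (kappa χ h)) =
      (fun h : logSpace K => (Real.cos (ℓ h) : ℂ)) + fun h : logSpace K => Complex.I • (Real.sin (ℓ h) : ℂ) := by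
    funext h'; simp only [Pi.add_apply, smul_eq_mul]; rw [eC_kappa_eq, hℓ]; ring
  have hcos : ContDiff ℝ (⊤ : ℕ∞) fun h : logSpace K => (Real.cos (ℓ h) : ℂ) :=
    Complex.ofRealCLM.contDiff.comp (Real.contDiff_cos.comp ℓ.contDiff)
  have hsin : ContDiff ℝ (⊤ : ℕ∞) fun h : logSpace K => (Real.sin (ℓ h) : ℂ) :=
    Complex.ofRealCLM.contDiff.comp (Real.contDiff_sin.comp ℓ.contDiff)
  have hcos' : ContDiff ℝ (a : ℕ∞) fun h : logSpace K => (Real.cos (ℓ h) : ℂ) := hcos.of_le (by exact_mod_cast le_top)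
  have hsin' : ContDiff ℝ (a : ℕ∞) fun h : logSpace K => (Real.sin (ℓ h) : ℂ) := hsin.of_le (by exact_mod_cast le_top)
  have hIsin : ContDiff ℝ (a : ℕ∞) fun h : logSpace K => Complex.I • (Real.sin (ℓ h) : ℂ) :=
    hsin'.const_smul Complex.I
  rw [hfun, iteratedFDeriv_add_apply hcos'.contDiffAt hIsin.contDiffAt,
    show (fun h : logSpace K => Complex.I • (Real.sin (ℓ h) : ℂ)) = Complex.I • fun h : logSpace K => (Real.sin (ℓ h) : ℂ) from rfl,
    iteratedFDeriv_const_smul_apply hsin'.contDiffAt]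
  refine (norm_add_le _ _).trans ?_
  rw [norm_smul, Complex.norm_I, one_mul, two_mul]
  refine add_le_add ?_ ?_
  · exact norm_iteratedFDeriv_ofReal_comp_le Real.contDiff_cos (fun b s => by
      rw [Real.norm_eq_abs]; exact Real.abs_iteratedDeriv_cos_le_one b s) ℓ a h
  · exact norm_iteratedFDeriv_ofReal_comp_le Real.contDiff_sin (fun b s => by
      rw [Real.norm_eq_abs]; exact Real.abs_iteratedDeriv_sin_le_one b s) ℓ a h

omit [IsTotallyReal K] in
/-- `‖e(x)‖ = 1`. [folklore] -/
theorem norm_eC (x : ℝ) : ‖eC x‖ = 1 := by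
  unfold eC
  rw [show (2 * (Real.pi : ℂ) * Complex.I * (x : ℂ)) = ((2 * Real.pi * x : ℝ) : ℂ) * Complex.I by push_cast; ring]
  exact Complex.norm_exp_ofReal_mul_I _

/-! ## Two complex factors, power form -/

omit [IsTotallyReal K] in
/-- **Two factors, power form** (complex values): `‖Dᵇ f‖ ≤ Lᵇ`, `‖Dᵇ g‖ ≤ Sᵇ` (`b ≤ n`, `L ≥ 0`)
give `‖Dᵃ (fg)‖ ≤ (L + S)ᵃ` for `a ≤ n`. [folklore] -/
theorem norm_iteratedFDeriv_mul_le_add_pow_complex {V : Type*} [NormedAddCommGroup V] [NormedSpace ℝ V]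
    {f g : V → ℂ} {n : ℕ} (hf : ContDiff ℝ n f) (hg : ContDiff ℝ n g) {L S : ℝ} (hL : 0 ≤ L) (x : V)
    (hfb : ∀ b ≤ n, ‖iteratedFDeriv ℝ b f x‖ ≤ L ^ b) (hgb : ∀ b ≤ n, ‖iteratedFDeriv ℝ b g x‖ ≤ S ^ b)
    {a : ℕ} (ha : a ≤ n) :
    ‖iteratedFDeriv ℝ a (fun y => f y * g y) x‖ ≤ (L + S) ^ a := by
  have h := norm_iteratedFDeriv_mul_le hf hg x (n := a) (by exact_mod_cast ha)
  have hsum : ∑ b ∈ Finset.range (a + 1),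
      (a.choose b : ℝ) * ‖iteratedFDeriv ℝ b f x‖ * ‖iteratedFDeriv ℝ (a - b) g x‖ ≤
      ∑ b ∈ Finset.range (a + 1), (a.choose b : ℝ) * L ^ b * S ^ (a - b) := by
    refine Finset.sum_le_sum fun b hb => ?_
    have hba : b ≤ a := Nat.lt_succ_iff.1 (Finset.mem_range.1 hb)
    have h1 := hfb b (hba.trans ha)
    have h2 := hgb (a - b) ((Nat.sub_le a b).trans ha)
    gcongr
  have heq : ∑ b ∈ Finset.range (a + 1), (a.choose b : ℝ) * L ^ b * S ^ (a - b) = (L + S) ^ a := by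
    rw [add_pow]
    exact Finset.sum_congr rfl fun b _ => by ring
  exact h.trans (hsum.trans_eq heq)

/-! ## The twisted bump -/

/-- **Uniform derivative bounds for the twisted bump**: for profiles with `|k_w| ≤ 1` and
`|k_w^{(a)}| ≤ L₀ᵃ` (`1 ≤ a ≤ n`), for every `a ≤ n` and every `h`,
`‖Dᵃ (gTw χ kf M t)(h)‖ ≤ (d L₀ (rk+1) + 2‖2πκ_χ‖)ᵃ`. [cite: Mitsui1956, §3] -/
theorem norm_iteratedFDeriv_gTw_le {kf : RP → ℝ → ℝ} (hk : ∀ w, ContDiff ℝ (⊤ : ℕ∞) (kf w))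
    (h1 : ∀ w v, ‖kf w v‖ ≤ 1) {L₀ : ℝ} (hL₀ : 0 ≤ L₀) {n : ℕ}
    (hD : ∀ w a, 1 ≤ a → a ≤ n → ∀ s, ‖iteratedDeriv a (kf w) s‖ ≤ L₀ ^ a) (M t : ℝ) {a : ℕ} (ha : a ≤ n) (h : logSpace K) :
    ‖iteratedFDeriv ℝ a (gTw χ kf M t) h‖ ≤
      ((Fintype.card RP : ℝ) * (L₀ * ((Fintype.card {w : InfinitePlace K // w ≠ w₀} : ℝ) + 1)) +
        2 * ‖(2 * Real.pi) • kappa χ‖) ^ a := by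
  have hfun : gTw χ kf M t = fun h : logSpace K => (fun h => (PhiT K kf M t h : ℂ)) h * (fun h => eC (kappa χ h)) h := rfl
  rw [hfun]
  have hP : ContDiff ℝ (⊤ : ℕ∞) fun h : logSpace K => (PhiT K kf M t h : ℂ) := Complex.ofRealCLM.contDiff.comp (contDiff_PhiT kf hk M t)
  have hE : ContDiff ℝ (⊤ : ℕ∞) fun h : logSpace K => eC (kappa χ h) := by
    unfold eC
    exact Complex.contDiff_exp.comp (contDiff_const.mul (Complex.ofRealCLM.contDiff.comp (kappa χ).contDiff))
  refine norm_iteratedFDeriv_mul_le_add_pow_complex (hP.of_le (by exact_mod_cast le_top)) (hE.of_le (by exact_mod_cast le_top))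
    (by positivity) h (fun b hb => ?_) (fun b hb => ?_) ha
  · -- the real product, embedded in `ℂ`
    have hcomp : (fun h : logSpace K => (PhiT K kf M t h : ℂ)) = Complex.ofRealLI ∘ PhiT K kf M t := rfl
    rw [hcomp, LinearIsometry.norm_iteratedFDeriv_comp_left _ ((contDiff_PhiT kf hk M t).contDiffAt) (by exact_mod_cast le_top)]
    exact norm_iteratedFDeriv_PhiT_le hk h1 hL₀ hD M t hb h
  · rcases Nat.eq_zero_or_pos b with rfl | hpos
    · rw [norm_iteratedFDeriv_zero, pow_zero, norm_eC]
    · refine (norm_iteratedFDeriv_eC_kappa_le χ b h).trans ?_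
      rw [mul_pow]
      refine mul_le_mul_of_nonneg_right ?_ (by positivity)
      calc (2 : ℝ) = 2 ^ 1 := (pow_one 2).symm
        _ ≤ 2 ^ b := pow_le_pow_right₀ (by norm_num) hpos

end Literature.NumberTheory.Sieve.ThetaUnits
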